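import Literature.NumberTheory.EllipticCurves.ModularFormsLevelCusps
import Literature.NumberTheory.EllipticCurves.ModularFormsLevelRankGeneral
import HarnessLib

/-!
# The cusp constraint `∑ k_j + 6·#(⟨T⟩-orbits) = 6[SL₂(ℤ) : Γ]` for every finite-index `Γ ∋ T`
# (the level theory of `ModularFormsLevelCusps` without `-1 ∈ Γ`)

`ModularFormsLevelCusps` computes the order of the basis determinant `𝒟` at `i∞` and proves
`Level.totalWeight_eq : ∑ k_j + 6·#basePoints(Γ) = 6[SL₂(ℤ):Γ]` for a level-one basis `(F_j)` of
`M(Γ)` with a `Level.RankInput Γ` (common weight, hence `-1 ∈ Γ`) and *even* weights `k_j`; the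
evenness enters only through the nonsingularity of the limit matrix `M₀`
(`limMat_mulVec_eq_zero`), whose test form `∑ c_j m_j F_j` needs level-one multipliers `m_j` of the
weights `M - k_j`, i.e. a common parity. For `Γ ∌ -1` (target: `Γ₁(N)`, odd weights) the basis has
weights of both parities (`ModularFormsLevelRankGeneral`). This file removes the restriction:

* `Level.slash_neg_one`, `Level.cosetSlash_neg_one_smul`: `F ∣_k (-1) = (-1)^k F`, so the
  conjugate attached to the coset `-x` is `(-1)^k` times that of `x`; `Level.width_neg_one_smul`.
* `Level.twistAvg_transl`, `Level.coeffAt_transl`, `Level.coeffAt_const_mul`: the `s`-th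
  `q_w`-coefficient of a translate `G(· + m)` is `e^{2πism/w}` times that of `G`.
* `Level.exists_row_neg`: **the rows of `M₀` come in signed pairs** — for every coset `x` there is a
  coset `y` (in the orbit of `-base x`) and `θ ≠ 0` with `M₀_{y,j} = θ (-1)^{k_j} M₀_{x,j}` for all
  `j`. Hence a relation `M₀ c = 0` splits into `M₀ c⁺ = 0 = M₀ c⁻` for the parts of `c` supported
  on the even resp. odd weights, and the test-form argument applies to each part with multipliers of
  its own parity (`exists_multipliers_parity`, `limMat_mulVec_eq_zero_of_parity`):
  **`limMat_mulVec_eq_zero'`**, `det_limMat_ne_zero'` — `M₀` is nonsingular for every level-one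
  basis with weights `≥ 0`.
* consequently, with the `𝒟 ≢ 0` versions of `ModularFormsLevelRankGeneral`:
  `tendsto_norm_basisDet_mul_exp'`, `totalWeight_eq_twelve_mul_cuspExp'`, and
  **`Level.totalWeight_eq'`**: `∑ k_j + 6·#basePoints(Γ) = 6[SL₂(ℤ) : Γ]` for every level-one
  basis indexed by `Fin [SL₂(ℤ):Γ]` with weights `≥ 0` and `𝒟 ≢ 0` — Gannon's Thm. 3.4(b)
  `∑ k_j = 12 Tr Λ` for the permutation representation on `SL₂(ℤ)/Γ`, `Γ ∌ -1` allowed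
  (`#basePoints` = number of `⟨T⟩`-orbits on `SL₂(ℤ)/Γ`; for `Γ ∌ -1` a regular cusp carries two
  orbits and an irregular cusp one).

Everything is proved; no named facts.

## References

* T. Gannon, *The theory of vector-valued modular forms for the modular group*, Contrib. Math.
  Comput. Sci. 8 (2014), 247–286, Thm. 3.4(b), §3.5.
* C. Marks, G. Mason, *Structure of the module of vector-valued modular forms*, J. London Math.
  Soc. (2) 82 (2010), 32–48.
-/

noncomputable section

open UpperHalfPlane hiding I
open ModularForm Complex Matrix.SpecialLinearGroup Filter Asymptotics CongruenceSubgroup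
open scoped MatrixGroups Real ModularForm Topology Manifold

namespace Literature.NumberTheory.EllipticCurves.ModularForms

namespace Level

/-! ### `-1`: slashing, conjugates and widths -/

section NegOne

variable {Γ : Subgroup SL(2, ℤ)}

local notation "𝕏" => SL(2, ℤ) ⧸ Γ

/-- `F ∣_k (-1) = (-1)^k F`. [folklore] -/
theorem slash_neg_one (k : ℤ) (F : ℍ → ℂ) :
    F ∣[k] ((-1 : SL(2, ℤ)) : GL (Fin 2) ℝ) = ((-1 : ℂ) ^ k) • F := by
  funext z
  have h1 : (-1 : SL(2, ℤ)) • z = z := by rw [ModularGroup.SL_neg_smul, one_smul]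
  have h2 : denom (↑(-1 : SL(2, ℤ)) : GL (Fin 2) ℝ) (z : ℂ) = -1 := by simp [denom]
  change (F ∣[k] (-1 : SL(2, ℤ))) z = _
  rw [ModularForm.SL_slash_apply, Pi.smul_apply, smul_eq_mul, h1, h2, mul_comm, zpow_neg]
  congr 1
  refine inv_eq_of_mul_eq_one_right ?_
  rw [← zpow_add₀ (by norm_num : (-1 : ℂ) ≠ 0), Even.neg_one_zpow ⟨k, rfl⟩]

/-- **The conjugate attached to `-x` is `(-1)^k` times that of `x`.** [folklore] -/
theorem cosetSlash_neg_one_smul {k : ℤ} {F : ℍ → ℂ} (hF : ∀ γ ∈ Γ, F ∣[k] (γ : GL (Fin 2) ℝ) = F)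
    (x : 𝕏) : cosetSlash Γ k F ((-1 : SL(2, ℤ)) • x) = ((-1 : ℂ) ^ k) • cosetSlash Γ k F x := by
  rw [← slash_neg_one, cosetSlash_slash hF, inv_neg_one]

/-- `T^n (-1·x) = -1·(T^n x)` (`-1` is central). [folklore] -/
theorem T_pow_smul_neg_one_smul (n : ℕ) (x : 𝕏) :
    ModularGroup.T ^ n • ((-1 : SL(2, ℤ)) • x) = (-1 : SL(2, ℤ)) • (ModularGroup.T ^ n • x) := by
  rw [smul_smul, smul_smul, mul_neg_one, neg_one_mul]

/-- `T^n (-1·x) = -1·(T^n x)` for `n ∈ ℤ`. [folklore] -/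
theorem T_zpow_smul_neg_one_smul (n : ℤ) (x : 𝕏) :
    ModularGroup.T ^ n • ((-1 : SL(2, ℤ)) • x) = (-1 : SL(2, ℤ)) • (ModularGroup.T ^ n • x) := by
  rw [smul_smul, smul_smul, mul_neg_one, neg_one_mul]

/-- The width is unchanged by `-1`: `w(-x) = w(x)`. [folklore] -/
theorem width_neg_one_smul (x : 𝕏) : width Γ ((-1 : SL(2, ℤ)) • x) = width Γ x := by
  have key : ∀ i : ℕ, width Γ ((-1 : SL(2, ℤ)) • x) ∣ i ↔ width Γ x ∣ i := fun i ↦ by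
    rw [← T_pow_smul_eq_iff, ← T_pow_smul_eq_iff, T_pow_smul_neg_one_smul]
    exact (MulAction.injective (-1 : SL(2, ℤ))).eq_iff
  exact Nat.dvd_antisymm ((key _).mpr dvd_rfl) ((key _).mp dvd_rfl)

end NegOne

/-! ### Coefficients of translates -/

section Coeff

variable {w : ℕ} [NeZero w]

omit [NeZero w] in
/-- `K_s(G(· + m)) = e^{2πism/w} · K_s(G)(· + m)`. [folklore] -/
theorem twistAvg_transl (s : ℕ) (m : ℤ) (G : ℍ → ℂ) (τ : ℍ) :
    twistAvg w s (transl m G) τ =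
      Complex.exp (2 * π * I * s * m / w) * twistAvg w s G ((ModularGroup.T ^ m) • τ) := by
  unfold twistAvg
  rw [Finset.mul_sum, Finset.mul_sum, Finset.mul_sum]
  refine Finset.sum_congr rfl fun i _ ↦ ?_
  simp only [transl]
  have hcomm : ModularGroup.T ^ (-(i : ℤ)) • ModularGroup.T ^ m • τ =
      ModularGroup.T ^ m • ModularGroup.T ^ (-(i : ℤ)) • τ := by
    rw [smul_smul, smul_smul, ← zpow_add, ← zpow_add, add_comm]
  rw [hcomm, twist_T_zpow_smul w s m (ModularGroup.T ^ (-(i : ℤ)) • τ)]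
  have : Complex.exp (2 * π * I * s * m / w) * Complex.exp (-(2 * π * I * s * m / w)) = 1 := by
    rw [← Complex.exp_add, add_neg_cancel, Complex.exp_zero]
  linear_combination (-(w : ℂ)⁻¹ * G (ModularGroup.T ^ m • ModularGroup.T ^ (-(i : ℤ)) • τ) *
    twist w s (ModularGroup.T ^ (-(i : ℤ)) • τ)) * this

omit [NeZero w] in
/-- A translate of a `w`-periodic bounded holomorphic function has the same three properties.
[folklore] -/
theorem transl_props {G : ℍ → ℂ} (m : ℤ) (hG : ∀ τ, G ((ModularGroup.T ^ (w : ℤ)) • τ) = G τ)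
    (hhol : MDiff G) (hbdd : IsBoundedAtImInfty G) :
    (∀ τ, transl m G ((ModularGroup.T ^ (w : ℤ)) • τ) = transl m G τ) ∧ MDiff (transl m G) ∧
      IsBoundedAtImInfty (transl m G) := by
  refine ⟨fun τ ↦ ?_, mdifferentiable_transl m hhol, ?_⟩
  · simp only [transl]
    rw [smul_smul, ← zpow_add, add_comm, zpow_add, mul_smul, hG]
  · exact hbdd.comp_tendsto (tendsto_T_zpow_smul_atImInfty m)

/-- **`coeffAt s (G(· + m)) = e^{2πism/w} coeffAt s G`** for `w`-periodic bounded holomorphic `G`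
and `s < w`. [folklore] -/
theorem coeffAt_transl {s : ℕ} (hs : s < w) {G : ℍ → ℂ} (m : ℤ)
    (hG : ∀ τ, G ((ModularGroup.T ^ (w : ℤ)) • τ) = G τ) (hhol : MDiff G) (hbdd : IsBoundedAtImInfty G) :
    coeffAt (w := w) s (transl m G) = Complex.exp (2 * π * I * s * m / w) * coeffAt (w := w) s G := by
  obtain ⟨hG', hhol', hbdd'⟩ := transl_props m hG hhol hbdd
  have h1 := tendsto_twistAvg hs hG' hhol' hbdd'
  have h2 : Tendsto (twistAvg w s (transl m G)) atImInfty
      (𝓝 (Complex.exp (2 * π * I * s * m / w) * coeffAt (w := w) s G)) := by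
    have := ((tendsto_twistAvg hs hG hhol hbdd).comp (tendsto_T_zpow_smul_atImInfty m)).const_mul
      (Complex.exp (2 * π * I * s * m / w))
    refine this.congr fun τ ↦ ?_
    rw [twistAvg_transl]
    rfl
  exact tendsto_nhds_unique h1 h2

/-- `coeffAt s (c·G) = c · coeffAt s G` for `w`-periodic bounded holomorphic `G`, `s < w`. [folklore] -/
theorem coeffAt_const_mul {s : ℕ} (hs : s < w) {G : ℍ → ℂ} (c : ℂ)
    (hG : ∀ τ, G ((ModularGroup.T ^ (w : ℤ)) • τ) = G τ) (hhol : MDiff G) (hbdd : IsBoundedAtImInfty G) :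
    coeffAt (w := w) s (c • G) = c * coeffAt (w := w) s G := by
  have heq : twistAvg w s (c • G) = fun τ ↦ c * twistAvg w s G τ := by
    funext τ
    unfold twistAvg transl
    simp only [Pi.smul_apply, smul_eq_mul, Finset.mul_sum]
    refine Finset.sum_congr rfl fun i _ ↦ by ring
  have hG' : ∀ τ, (c • G) ((ModularGroup.T ^ (w : ℤ)) • τ) = (c • G) τ := fun τ ↦ by
    simp only [Pi.smul_apply, hG]
  have hbdd' : IsBoundedAtImInfty (c • G) := hbdd.const_smul_left c
  have h1 := tendsto_twistAvg hs hG' (hhol.const_smul c) hbdd'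
  have h2 : Tendsto (twistAvg w s (c • G)) atImInfty (𝓝 (c * coeffAt (w := w) s G)) := by
    rw [heq]
    exact (tendsto_twistAvg hs hG hhol hbdd).const_mul c
  exact tendsto_nhds_unique h1 h2

end Coeff

/-! ### The rows of `M₀` come in signed pairs -/

section Rows

variable {Γ : Subgroup SL(2, ℤ)} [Γ.FiniteIndex]

local notation "𝕏" => SL(2, ℤ) ⧸ Γ

open scoped Classical

variable {wt : Fin (Γ.index) → ℤ} {F : Fin (Γ.index) → ℍ → ℂ}

omit [Γ.FiniteIndex] in
/-- `cosetSlash (Tⁿ y) = transl (-n) (cosetSlash y)` for `n ∈ ℤ`. [folklore] -/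
theorem cosetSlash_T_zpow_smul {k : ℤ} {G : ℍ → ℂ} (hG : G ∈ levelSpace Γ k) (y : 𝕏) (n : ℤ) :
    cosetSlash Γ k G ((ModularGroup.T ^ n) • y) = transl (-n) (cosetSlash Γ k G y) := by
  rw [← slash_T_zpow_eq_transl k, cosetSlash_slash (slash_eq_of_mem_levelSpace hG), zpow_neg, inv_inv]

/-- **Signed pairing of the rows of `M₀`.** For every coset `x` there are a coset `y` and `θ ≠ 0`
with `M₀_{y,j} = θ·(-1)^{k_j}·M₀_{x,j}` for all `j`: with `b = base x`, `x = T^r b`, take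
`y = T^r b₁` where `b₁ = base(-b) = T^{-i₀}(-b)`; then the rows of `b₁` are
`(F_j ∣ ·)(b₁) = (-1)^{k_j} (F_j ∣ ·)(b)(· + i₀)`, whose `r`-th coefficients are
`e^{2πi r i₀/w}(-1)^{k_j}` times those of `b`. [folklore] -/
theorem exists_row_neg (hb : IsLevelBasis Γ wt F) (x : 𝕏) :
    ∃ (y : 𝕏) (θ : ℂ), θ ≠ 0 ∧ ∀ j,
      limMat Γ wt F (cosetEquiv Γ y) j = θ * (-1 : ℂ) ^ wt j * limMat Γ wt F (cosetEquiv Γ x) j := by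
  set b := base Γ x with hbdef
  set r := off Γ x with hr
  set w := width Γ x with hw
  have hrw : r < w := off_lt_width Γ x
  have hxb : ModularGroup.T ^ r • b = x := T_pow_off_smul_base Γ x
  set nb : 𝕏 := (-1 : SL(2, ℤ)) • b with hnb
  set b₁ := base Γ nb with hb₁
  set i₀ := off Γ nb with hi₀
  have hb₁eq : b₁ = (ModularGroup.T ^ (-(i₀ : ℤ))) • nb := (T_zpow_neg_off_smul nb).symm
  have hwb : width Γ b = w := by rw [hbdef, width_base]
  have hwnb : width Γ nb = w := by rw [hnb, width_neg_one_smul, hwb]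
  have hwb₁ : width Γ b₁ = w := by rw [hb₁, width_base, hwnb]
  set y : 𝕏 := ModularGroup.T ^ r • b₁ with hy
  refine ⟨y, Complex.exp (2 * π * I * r * (i₀ : ℤ) / w), Complex.exp_ne_zero _, fun j ↦ ?_⟩
  -- the row of `y`
  have hbase₁ : base Γ b₁ = b₁ := by rw [hb₁, base_base]
  have h1 : limMat Γ wt F (cosetEquiv Γ y) j = coeffAt (w := width Γ b₁) r (rowFun Γ wt F b₁ j) := by
    have := limMat_orbit (wt := wt) (F := F) b₁ (r := r) (by rw [hwb₁]; exact hrw) j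
    rwa [hbase₁] at this
  -- the row of `x`
  have h2 : limMat Γ wt F (cosetEquiv Γ x) j = coeffAt (w := width Γ x) r (rowFun Γ wt F b j) := by
    have := limMat_orbit (wt := wt) (F := F) x (r := r) hrw j
    rwa [← hbdef, hxb] at this
  -- the rows of `b₁` in terms of those of `b`
  have hF := slash_eq_of_mem_levelSpace (hb.mem j)
  have hrow : rowFun Γ wt F b₁ j = transl (i₀ : ℤ) (((-1 : ℂ) ^ wt j) • rowFun Γ wt F b j) := by
    rw [rowFun, hb₁eq, cosetSlash_T_zpow_smul (hb.mem j), neg_neg, hnb, cosetSlash_neg_one_smul hF]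
    rfl
  -- properties of the row of `b`
  have hper : ∀ τ, rowFun Γ wt F b j ((ModularGroup.T ^ (w : ℤ)) • τ) = rowFun Γ wt F b j τ := fun τ ↦ by
    have := rowFun_T_pow_width_smul hb b j τ
    rwa [hwb] at this
  have hhol : MDiff (rowFun Γ wt F b j) := mdifferentiable_cosetSlash (hb.mem j) _
  have hbdd : IsBoundedAtImInfty (rowFun Γ wt F b j) := isBoundedAtImInfty_cosetSlash (hb.mem j) _
  have hper' : ∀ τ, (((-1 : ℂ) ^ wt j) • rowFun Γ wt F b j) ((ModularGroup.T ^ (w : ℤ)) • τ) =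
      (((-1 : ℂ) ^ wt j) • rowFun Γ wt F b j) τ := fun τ ↦ by simp only [Pi.smul_apply, hper]
  haveI : NeZero w := ⟨(width_pos Γ x).ne'⟩
  rw [h1, h2, coeffAt_congr hwb₁ rfl, coeffAt_congr hw.symm rfl, hrow,
    coeffAt_transl hrw (i₀ : ℤ) hper' (hhol.const_smul _) (hbdd.const_smul_left _),
    coeffAt_const_mul hrw _ hper hhol hbdd]
  ring

/-- **Parity splitting**: if `M₀ c = 0` then `M₀ c^ε = 0` for the part `c^ε` of `c` supported on the
weights of parity `ε ∈ {0, 1}`. [folklore] -/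
theorem limMat_mulVec_parity (hb : IsLevelBasis Γ wt F)
    {c : Fin (Γ.index) → ℂ} (hc : (limMat Γ wt F).mulVec c = 0) (ε : ℤ) (hε : ε = 0 ∨ ε = 1) :
    (limMat Γ wt F).mulVec (fun j ↦ if wt j % 2 = ε then c j else 0) = 0 := by
  funext a
  rw [Pi.zero_apply, Matrix.mulVec, dotProduct]
  set x : 𝕏 := (cosetEquiv Γ).symm a with hx
  have ha : a = cosetEquiv Γ x := by rw [hx, Equiv.apply_symm_apply]
  obtain ⟨y, θ, hθ, hrow⟩ := exists_row_neg hb x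
  have R1 : ∑ j, limMat Γ wt F a j * c j = 0 := by
    have := congr_fun hc a
    rwa [Matrix.mulVec, dotProduct] at this
  have R2 : ∑ j, (-1 : ℂ) ^ wt j * (limMat Γ wt F a j * c j) = 0 := by
    have := congr_fun hc (cosetEquiv Γ y)
    rw [Pi.zero_apply, Matrix.mulVec, dotProduct] at this
    simp_rw [hrow, ← ha] at this
    have h' : θ * ∑ j, (-1 : ℂ) ^ wt j * (limMat Γ wt F a j * c j) = 0 := by
      rw [Finset.mul_sum, ← this]
      refine Finset.sum_congr rfl fun j _ ↦ by ring
    exact (mul_eq_zero.mp h').resolve_left hθ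
  -- the sign `(-1)^ε (-1)^{k_j}` selects the parity `ε`
  have hterm : ∀ j, limMat Γ wt F a j * (if wt j % 2 = ε then c j else 0) =
      (limMat Γ wt F a j * c j + (-1 : ℂ) ^ ε * ((-1 : ℂ) ^ wt j * (limMat Γ wt F a j * c j))) / 2 := by
    intro j
    rcases Int.even_or_odd (wt j) with he | ho <;> rcases hε with rfl | rfl
    · rw [if_pos (Int.even_iff.mp he), he.neg_one_zpow, zpow_zero]; ring
    · rw [if_neg (by have := Int.even_iff.mp he; omega), he.neg_one_zpow, zpow_one]; ring
    · rw [if_neg (by have := Int.odd_iff.mp ho; omega), ho.neg_one_zpow, zpow_zero]; ring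
    · rw [if_pos (Int.odd_iff.mp ho), ho.neg_one_zpow, zpow_one]; ring
  simp_rw [hterm]
  rw [← Finset.sum_div, Finset.sum_add_distrib, ← Finset.mul_sum, R1, R2]
  simp

end Rows

/-! ### Nonsingularity of `M₀` for weights of both parities -/

section LimMat

variable {Γ : Subgroup SL(2, ℤ)} [Γ.FiniteIndex]

local notation "𝕏" => SL(2, ℤ) ⧸ Γ

open scoped Classical

variable {wt : Fin (Γ.index) → ℤ} {F : Fin (Γ.index) → ℍ → ℂ}

omit [Γ.FiniteIndex] in
/-- Level-one multipliers with constant term `1` on the generators of one parity `ε`: a common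
weight `M ≡ ε (2)` and `m_j ∈ R_{M - k_j}`, with `m_j → 1` at `i∞` when `k_j ≡ ε` (and `m_j = 0`
otherwise). [folklore] -/
theorem exists_multipliers_parity (hwt : ∀ j, 0 ≤ wt j) (ε : ℤ) :
    ∃ (M : ℤ) (m : Fin (Γ.index) → ℍ → ℂ), (∀ j, m j ∈ levelOneSpace (M - wt j)) ∧
      ∀ j, wt j % 2 = ε → Tendsto (m j) atImInfty (𝓝 1) := by
  have hT : ∀ j, wt j ≤ totalWeight Γ wt := fun j ↦ by
    unfold totalWeight
    exact Finset.single_le_sum (fun i _ ↦ hwt i) (Finset.mem_univ j)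
  set M : ℤ := 2 * totalWeight Γ wt + 4 + ε with hM
  have key : ∀ j, ∃ m : ℍ → ℂ, m ∈ levelOneSpace (M - wt j) ∧
      (wt j % 2 = ε → Tendsto m atImInfty (𝓝 1)) := by
    intro j
    by_cases hj : wt j % 2 = ε
    · have h0 := hwt j
      have hTj := hT j
      obtain ⟨n, hn⟩ : ∃ n : ℕ, M - wt j = n :=
        ⟨(M - wt j).toNat, (Int.toNat_of_nonneg (by omega)).symm⟩
      have h4 : 4 ≤ n := by omega
      have heven : Even n := by
        rw [← Int.even_coe_nat, ← hn, Int.even_iff]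
        omega
      obtain ⟨m, -, hm, ht⟩ := exists_levelOne_tendsto_one h4 heven
      exact ⟨m, hn ▸ hm, fun _ ↦ ht⟩
    · exact ⟨0, Submodule.zero_mem _, fun h ↦ absurd h hj⟩
  choose m hm ht using key
  exact ⟨M, m, hm, ht⟩

/-- **`M₀ c = 0 ⇒ c = 0` for `c` supported on the weights of one parity** (the test-form argument
of `limMat_mulVec_eq_zero` with multipliers of that parity). [folklore] -/
theorem limMat_mulVec_eq_zero_of_parity (hb : IsLevelBasis Γ wt F) (hwt : ∀ j, 0 ≤ wt j)
    (ε : ℤ) {c : Fin (Γ.index) → ℂ} (hsupp : ∀ j, wt j % 2 ≠ ε → c j = 0)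
    (hc : (limMat Γ wt F).mulVec c = 0) : c = 0 := by
  obtain ⟨M, m, hm, ht⟩ := exists_multipliers_parity (Γ := Γ) (wt := wt) hwt ε
  -- the test form `G = ∑ c_j m_j F_j`
  set p : Fin (Γ.index) → ℍ → ℂ := fun j ↦ c j • m j with hp
  have hpmem : ∀ j, p j ∈ levelOneSpace (M - wt j) := fun j ↦ Submodule.smul_mem _ _ (hm j)
  have hpt : ∀ j, Tendsto (p j) atImInfty (𝓝 (c j)) := fun j ↦ by
    by_cases hj : wt j % 2 = ε
    · rw [show p j = fun τ ↦ c j * m j τ from rfl]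
      simpa using (ht j hj).const_mul (c j)
    · rw [hsupp j hj, show p j = fun τ ↦ c j * m j τ from rfl, hsupp j hj]
      simp
  set G : ℍ → ℂ := ∑ j, p j * F j with hG
  have hGmem : G ∈ levelSpace Γ M := by
    refine Submodule.sum_mem _ fun j _ ↦ ?_
    have := levelOne_mul_mem Γ (hpmem j) (hb.mem j)
    rwa [sub_add_cancel] at this
  have hslash : ∀ x : 𝕏, cosetSlash Γ M G x = ∑ j, p j * rowFun Γ wt F x j :=
    cosetSlash_sum_levelOne_mul hb hpmem hGmem
  have hperG : ∀ x : 𝕏, ∀ τ, cosetSlash Γ M G (base Γ x) ((ModularGroup.T ^ (width Γ x : ℤ)) • τ) =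
      cosetSlash Γ M G (base Γ x) τ := fun x τ ↦ by
    have := cosetSlash_T_pow_width_smul hGmem (base Γ x) τ
    rwa [width_base] at this
  have hperF : ∀ x : 𝕏, ∀ j τ, rowFun Γ wt F (base Γ x) j ((ModularGroup.T ^ (width Γ x : ℤ)) • τ) =
      rowFun Γ wt F (base Γ x) j τ := fun x j τ ↦ by
    have := rowFun_T_pow_width_smul hb (base Γ x) j τ
    rwa [width_base] at this
  -- Step 1: all projections of `G ∣ base x` decay
  have hcoef : ∀ x : 𝕏, ∀ r < width Γ x,
      twistAvg (width Γ x) r (cosetSlash Γ M G (base Γ x)) =O[atImInfty]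
        fun τ : ℍ ↦ Real.exp (-2 * π * τ.im) := by
    intro x r hr
    refine isBigO_twistAvg_of_coeffAt_eq_zero hr (hperG x) (mdifferentiable_cosetSlash hGmem _)
      (isBoundedAtImInfty_cosetSlash hGmem _) ?_
    have hlim := tendsto_twistAvg hr (hperG x) (mdifferentiable_cosetSlash hGmem _)
      (isBoundedAtImInfty_cosetSlash hGmem _)
    have hlim' : Tendsto (twistAvg (width Γ x) r (cosetSlash Γ M G (base Γ x))) atImInfty (𝓝 0) := by
      have heq : twistAvg (width Γ x) r (cosetSlash Γ M G (base Γ x)) =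
          fun τ ↦ ∑ j, p j τ * twistAvg (width Γ x) r (rowFun Γ wt F (base Γ x) j) τ := by
        funext τ
        rw [hslash, twistAvg_sum_levelOne_mul _ _ _ (fun j _ ↦ hpmem j)]
      rw [heq]
      have hrow : ∀ j, Tendsto (fun τ ↦ p j τ * twistAvg (width Γ x) r (rowFun Γ wt F (base Γ x) j) τ)
          atImInfty (𝓝 (c j * coeffAt (w := width Γ x) r (rowFun Γ wt F (base Γ x) j))) := fun j ↦
        (hpt j).mul (tendsto_twistAvg hr (hperF x j) (mdifferentiable_cosetSlash (hb.mem j) _)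
          (isBoundedAtImInfty_cosetSlash (hb.mem j) _))
      have hsum := tendsto_finsetSum Finset.univ fun j _ ↦ hrow j
      have h0 : ∑ j, c j * coeffAt (w := width Γ x) r (rowFun Γ wt F (base Γ x) j) = 0 := by
        have := congr_fun hc (cosetEquiv Γ (ModularGroup.T ^ r • base Γ x))
        rw [Matrix.mulVec, dotProduct, Pi.zero_apply] at this
        rw [← this]
        refine Finset.sum_congr rfl fun j _ ↦ ?_
        rw [limMat_orbit x hr, mul_comm]
      rwa [h0] at hsum
    exact tendsto_nhds_unique hlim hlim'
  -- Step 2: every conjugate of `G` decays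
  have hdecay : ∀ y : 𝕏, cosetSlash Γ M G y =O[atImInfty] fun τ : ℍ ↦ Real.exp (-2 * π * τ.im) := by
    intro y
    have hy : cosetSlash Γ M G y = transl (-(off Γ y : ℤ)) (cosetSlash Γ M G (base Γ y)) := by
      rw [transl_cosetSlash hGmem, T_pow_off_smul_base]
    rw [hy]
    refine isBigO_transl _ ?_
    have heq : cosetSlash Γ M G (base Γ y) = fun τ : ℍ ↦ ∑ r ∈ Finset.range (width Γ y),
        Function.Periodic.qParam (width Γ y) τ ^ r * twistAvg (width Γ y) r (cosetSlash Γ M G (base Γ y)) τ := by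
      funext τ
      exact (sum_qParam_pow_mul_twistAvg y τ).symm
    rw [heq]
    refine IsBigO.sum fun r hr ↦ ?_
    have hq : (fun τ : ℍ ↦ Function.Periodic.qParam (width Γ y) τ ^ r) =O[atImInfty] fun _ : ℍ ↦ (1 : ℝ) :=
      IsBigO.of_bound 1 (Filter.Eventually.of_forall fun τ ↦ by
        rw [norm_one, mul_one]; exact norm_qParam_pow_le _ _ _)
    have := hq.mul (hcoef y r (Finset.mem_range.mp hr))
    simpa using this
  -- Step 3: `g = G/Δ ∈ A_{M-12}`
  set g : ℍ → ℂ := fun τ ↦ G τ / ModularForm.discriminant τ with hg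
  have hgmem : g ∈ levelSpace Γ (M - 12) := by
    rw [mem_formSpace_iff]
    refine ⟨?_, ?_, ?_⟩
    · intro τ
      rw [UpperHalfPlane.mdifferentiableAt_iff]
      exact (UpperHalfPlane.mdifferentiableAt_iff.mp (mdifferentiable_of_mem_formSpace hGmem τ)).div
        (UpperHalfPlane.mdifferentiableAt_iff.mp (CuspForm.discriminant.holo' τ))
        (by simpa [ofComplex_apply] using discriminant_ne_zero τ)
    · rintro _ ⟨γ, hγ, rfl⟩
      show (fun τ ↦ G τ / ModularForm.discriminant τ) ∣[M - 12] (γ : GL (Fin 2) ℝ) = _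
      rw [div_discriminant_slash, slash_eq_of_mem_levelSpace hGmem γ hγ]
    · intro g'
      show IsBoundedAtImInfty ((fun τ ↦ G τ / ModularForm.discriminant τ) ∣[M - 12] (g' : GL (Fin 2) ℝ))
      rw [div_discriminant_slash]
      have : G ∣[M] (g' : GL (Fin 2) ℝ) = cosetSlash Γ M G ((g'⁻¹ : SL(2, ℤ)) : 𝕏) := by
        rw [cosetSlash_mk (slash_eq_of_mem_levelSpace hGmem), inv_inv]
      rw [this]
      exact isBoundedAtImInfty_div_discriminant (hdecay _)
  -- Step 4: compare the two expansions of `G`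
  obtain ⟨p', hp'mem, hp'eq⟩ := hb.span (M - 12) g hgmem
  have hΔmem : (ModularForm.discriminant : ℍ → ℂ) ∈ levelOneSpace 12 :=
    coe_mem_formSpace (CuspForm.discriminant : ModularForm 𝒮ℒ 12)
  have hcoefmem : ∀ j, p j - ModularForm.discriminant * p' j ∈ levelOneSpace (M - wt j) := by
    intro j
    refine Submodule.sub_mem _ (hpmem j) ?_
    have := mul_mem_formSpace hΔmem (hp'mem j)
    rwa [show (12 : ℤ) + (M - 12 - wt j) = M - wt j by ring] at this
  have hrel : ∑ j, (p j - ModularForm.discriminant * p' j) * F j = 0 := by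
    have h1 : ∀ τ, ModularForm.discriminant τ * g τ = G τ := fun τ ↦ by
      rw [hg]
      exact mul_div_cancel₀ _ (discriminant_ne_zero τ)
    funext τ
    have h2 := h1 τ
    rw [hp'eq] at h2
    simp only [Finset.sum_apply, Pi.mul_apply, Finset.mul_sum] at h2
    have h3 : G τ = ∑ j, p j τ * F j τ := by simp [hG, Finset.sum_apply]
    simp only [Finset.sum_apply, Pi.mul_apply, Pi.sub_apply, Pi.zero_apply, sub_mul,
      Finset.sum_sub_distrib]
    rw [← h3, ← h2]
    simp only [mul_assoc, sub_self]
  have hzero := hb.indep M _ hcoefmem hrel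
  -- Step 5: constant terms
  funext j
  rw [Pi.zero_apply]
  have hbd : IsBoundedAtImInfty (p' j) := by
    have := isBoundedAtImInfty_slash_of_mem_formSpace (hp'mem j) 1
    simpa using this
  have h0 : (ModularForm.discriminant : ℍ → ℂ) =o[atImInfty] (fun _ : ℍ ↦ (1 : ℝ)) :=
    (Asymptotics.isLittleO_one_iff ℝ).mpr discriminant_isZeroAtImInfty
  have hlim0 : Tendsto (fun τ ↦ ModularForm.discriminant τ * p' j τ) atImInfty (𝓝 0) := by
    have := h0.mul_isBigO hbd
    simp only [Pi.one_apply, mul_one] at this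
    exact (Asymptotics.isLittleO_one_iff ℝ).mp this
  have heq : p j = fun τ ↦ ModularForm.discriminant τ * p' j τ := by
    have := hzero j
    rw [sub_eq_zero] at this
    rw [this]
    rfl
  exact tendsto_nhds_unique (heq ▸ hpt j) hlim0

/-- **`M₀` is nonsingular for a level-one basis with weights `≥ 0` of both parities**: if
`M₀ c = 0` then `c = 0` (split `c` by parity with `limMat_mulVec_parity`). [folklore] -/
theorem limMat_mulVec_eq_zero' (hb : IsLevelBasis Γ wt F) (hwt : ∀ j, 0 ≤ wt j)
    {c : Fin (Γ.index) → ℂ} (hc : (limMat Γ wt F).mulVec c = 0) : c = 0 := by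
  have h0 := limMat_mulVec_eq_zero_of_parity hb hwt 0 (c := fun j ↦ if wt j % 2 = 0 then c j else 0)
    (fun j hj ↦ if_neg hj) (limMat_mulVec_parity hb hc 0 (Or.inl rfl))
  have h1 := limMat_mulVec_eq_zero_of_parity hb hwt 1 (c := fun j ↦ if wt j % 2 = 1 then c j else 0)
    (fun j hj ↦ if_neg hj) (limMat_mulVec_parity hb hc 1 (Or.inr rfl))
  funext j
  have hj0 := congr_fun h0 j
  have hj1 := congr_fun h1 j
  simp only [Pi.zero_apply] at hj0 hj1
  rcases Int.emod_two_eq_zero_or_one (wt j) with h | h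
  · simpa [h] using hj0
  · simpa [h] using hj1

/-- `det M₀ ≠ 0`. [folklore] -/
theorem det_limMat_ne_zero' (hb : IsLevelBasis Γ wt F) (hwt : ∀ j, 0 ≤ wt j) :
    (limMat Γ wt F).det ≠ 0 := by
  intro h
  obtain ⟨v, hv, hMv⟩ := Matrix.exists_mulVec_eq_zero_iff.mpr h
  exact hv (limMat_mulVec_eq_zero' hb hwt hMv)

/-- **Exact decay rate of `𝒟` at `i∞`**: `‖𝒟(τ)‖ e^{2π t Im τ} → ‖det M₀‖/‖det L‖ > 0`. [folklore] -/
theorem tendsto_norm_basisDet_mul_exp' (hb : IsLevelBasis Γ wt F) (hwt : ∀ j, 0 ≤ wt j) :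
    ∃ A : ℝ, 0 < A ∧ Tendsto (fun τ : ℍ ↦ ‖basisDet Γ wt F τ‖ * Real.exp (2 * π * cuspExp Γ * τ.im))
      atImInfty (𝓝 A) := by
  have hL := det_dftMat_ne_zero (Γ := Γ)
  have hM := det_limMat_ne_zero' hb hwt
  refine ⟨‖(limMat Γ wt F).det‖ / ‖(dftMat Γ).det‖,
    div_pos (norm_pos_iff.mpr hM) (norm_pos_iff.mpr hL), ?_⟩
  have key : ∀ τ : ℍ, ‖basisDet Γ wt F τ‖ * Real.exp (2 * π * cuspExp Γ * τ.im) =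
      ‖(coefMat Γ wt F τ).det‖ / ‖(dftMat Γ).det‖ := by
    intro τ
    have h1 : (dftMat Γ).det * basisDet Γ wt F τ = (∏ a, qFactor Γ a τ) * (coefMat Γ wt F τ).det := by
      rw [basisDet, ← Matrix.det_mul, ← projMat_eq_mul, det_projMat hb]
    have h2 := congrArg norm h1
    rw [norm_mul, norm_mul, norm_prod_qFactor] at h2
    rw [eq_div_iff (norm_ne_zero_iff.mpr hL)]
    have hexp : Real.exp (-2 * π * cuspExp Γ * τ.im) * Real.exp (2 * π * cuspExp Γ * τ.im) = 1 := by
      rw [← Real.exp_add]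
      convert Real.exp_zero using 2
      ring
    calc ‖basisDet Γ wt F τ‖ * Real.exp (2 * π * cuspExp Γ * τ.im) * ‖(dftMat Γ).det‖
        = (‖(dftMat Γ).det‖ * ‖basisDet Γ wt F τ‖) * Real.exp (2 * π * cuspExp Γ * τ.im) := by ring
      _ = Real.exp (-2 * π * cuspExp Γ * τ.im) * ‖(coefMat Γ wt F τ).det‖ *
            Real.exp (2 * π * cuspExp Γ * τ.im) := by rw [h2]
      _ = ‖(coefMat Γ wt F τ).det‖ := by
          rw [mul_comm (Real.exp _), mul_assoc, hexp, mul_one]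
  simp_rw [key]
  exact ((tendsto_det_coefMat hb).norm).div_const _

/-- **`K = ∑ k_j = 12 t`** from `𝒟 ≢ 0` and weights `≥ 0`. [cite: Gannon2014, Thm. 3.4(b)] -/
theorem totalWeight_eq_twelve_mul_cuspExp' (hb : IsLevelBasis Γ wt F) (hD : ∃ τ, basisDet Γ wt F τ ≠ 0)
    (hwt : ∀ j, 0 ≤ wt j) : (totalWeight Γ wt : ℝ) = 12 * cuspExp Γ := by
  have hK : 0 ≤ totalWeight Γ wt := totalWeight_nonneg' hwt
  obtain ⟨C, hC, hCt⟩ := tendsto_norm_basisDet_pow_of_exists hb hD hK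
  obtain ⟨A, hA, hAt⟩ := tendsto_norm_basisDet_mul_exp' hb hwt
  set s : ℝ := (totalWeight Γ wt : ℝ) - 12 * cuspExp Γ with hs
  have hKnat : ((totalWeight Γ wt).toNat : ℝ) = (totalWeight Γ wt : ℝ) := by
    exact_mod_cast Int.toNat_of_nonneg hK
  have hq : Tendsto (fun τ : ℍ ↦ Real.exp (2 * π * s * τ.im)) atImInfty (𝓝 (C / A ^ 12)) := by
    have h := hCt.div (hAt.pow 12) (pow_ne_zero _ hA.ne')
    refine h.congr' (Filter.Eventually.of_forall fun τ ↦ ?_)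
    have hD' : 0 < ‖basisDet Γ wt F τ‖ := norm_pos_iff.mpr (basisDet_ne_zero_of_exists hb hD hK τ)
    simp only [Pi.div_apply]
    rw [hKnat, mul_pow, ← Real.exp_nat_mul, mul_div_mul_left _ _ (pow_ne_zero 12 hD'.ne'),
      ← Real.exp_sub, hs]
    congr 1
    push_cast
    ring
  have him : Tendsto (fun τ : ℍ ↦ τ.im) atImInfty atTop := by
    rw [atImInfty]
    exact Filter.tendsto_comap
  rcases lt_trichotomy s 0 with hneg | h0 | hpos
  · have h0' : Tendsto (fun τ : ℍ ↦ Real.exp (2 * π * s * τ.im)) atImInfty (𝓝 0) := by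
      refine Real.tendsto_exp_atBot.comp ?_
      have : Tendsto (fun y : ℝ ↦ 2 * π * s * y) atTop atBot :=
        Tendsto.const_mul_atTop_of_neg (by nlinarith [Real.pi_pos]) tendsto_id
      exact this.comp him
    have := tendsto_nhds_unique hq h0'
    exact absurd this (div_pos hC (pow_pos hA 12)).ne'
  · linarith
  · have h0' : Tendsto (fun τ : ℍ ↦ Real.exp (2 * π * s * τ.im)) atImInfty atTop := by
      refine Real.tendsto_exp_atTop.comp ?_
      have : Tendsto (fun y : ℝ ↦ 2 * π * s * y) atTop atTop :=
        Tendsto.const_mul_atTop (by positivity) tendsto_id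
      exact this.comp him
    exact absurd hq (not_tendsto_nhds_of_tendsto_atTop h0' _)

/-- **The cusp constraint for every finite-index `Γ ∋ T`**:
`∑_j k_j + 6·#basePoints(Γ) = 6[SL₂(ℤ) : Γ]` for a level-one basis on `Fin [SL₂(ℤ):Γ]` with weights
`≥ 0` and `𝒟 ≢ 0` (no hypothesis on `-1` or on parities). [cite: Gannon2014, Thm. 3.4(b)] -/
theorem totalWeight_eq' (hb : IsLevelBasis Γ wt F) (hD : ∃ τ, basisDet Γ wt F τ ≠ 0)
    (hwt : ∀ j, 0 ≤ wt j) :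
    totalWeight Γ wt + 6 * (basePoints Γ).card = 6 * Γ.index := by
  have h1 := totalWeight_eq_twelve_mul_cuspExp' hb hD hwt
  have h2 := two_mul_cuspExp (Γ := Γ)
  have h3 : (totalWeight Γ wt : ℝ) + 6 * (basePoints Γ).card = 6 * Γ.index := by linarith
  exact_mod_cast h3

end LimMat

end Level

end Literature.NumberTheory.EllipticCurves.ModularForms
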